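import Mathlib
import Literature.NumberTheory.LFunctions.Zhang2022.Section7bDischarges
import Literature.NumberTheory.LFunctions.Zhang2022.Section7aStatements
import Literature.NumberTheory.LFunctions.Zhang2022.Section14Majorant1413
import HarnessLib

/-!
# Zhang (2022) §7 p. 36, the error sums `E₇₇`/`F₇₇` of (7.7) and tex L1944 — elementary lemmas
# (divisor majorants, the support bound `PT⁻²`, the window lemma at `X = qk`, the `d`-sum)

Topic `Literature/NumberTheory/LFunctions/Zhang2022` (Landau–Siegel audit tree; verdict-neutral).
Y. Zhang, *Discrete mean estimates and the Landau–Siegel zero*, arXiv:2211.02515v1 (2022)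
[Zhang2022LandauSiegel] — **an unrefereed manuscript under adjudication; nothing here asserts or
denies its Theorems 1–2.** Campaign D-0069 (discharge lane, layer L2, seat d23); THEOREM-ONLY,
no fact beyond Mathlib and tree theorems.

These are the generic pieces of the crude absolute estimation of the two explicit error sums the
tree's `Section7bDischarges` (L2-t3) extracted from §7 p. 36: `E₇₇` (the `(1 − e(lk̄/p))`-weighted
sum behind (7.7), "by Lemma 5.4") and `F₇₇` (the `p ∣ l` terms behind "by trivial estimation, this
remains valid if the constraint `(l,p) = 1` is removed", tex L1944); the estimates themselves are
`Section7Eq77Bounds.hE77_holds / hF77_holds`.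

| decl | content |
|---|---|
| `tau_succ_le_card_divisors_pow`, `tau_five_le` | `τ_{j+1}(n) ≤ d(n)ʲ`, `τ₅ ≤ d⁴` (`τ_k` = `MeanSquareMajorant.tau k`) |
| `norm_kappaConv_le_card` | `|(κ∗a₁)(m)| ≤ B·d(m)⁴` (tree `Section7aStatements.norm_kconv_le_tau_five`) |
| `norm_one_sub_exp_twist_le` | `|1 − e(lk̄/p)| ≤ 2` |
| `card_Ico_Nsupp_le`, `one_add_log_card_le`, `Ico_Nsupp_eq_Icc`, `bounds_of_mem_Ico_Nsupp` | `N = ⌈PT⁻²⌉`: `#{1 ≤ k < N} ≤ PT⁻²`, `1 + log # ≤ 2𝓛⁹`, `1 ≤ k ≤ P` |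
| `window_at` | sz-d31's window lemma `Typed.Sec14.tsum_divisors_pow_mul_norm_DeltaW_le` at `X = qk` (`q ≤ 2P`, `k ≤ P`): `Σ_l d(l)⁴|Δ(l/(qk))| ≤ K_W·qk·𝓛⁶⁷⁴` |
| `outer_sum_le` | `|Σ_{d<N} d⁻¹S(d)| ≤ K·2¹⁶𝓛¹⁴⁴·PT⁻²` when `|S(d)| ≤ K·d(d)⁴·#{k<N}` (tree `sum_card_divisors_pow_div_le_log_pow`) |
| `absorb_le` | `M𝓛⁸¹⁸ ≤ T ⇒ M𝓛⁸¹⁸·PT⁻² ≤ PT⁻¹` |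
| `l53_max` | Lemma 5.3 at `D` with constant `max C 0` |

## References

* Y. Zhang, arXiv:2211.02515v1 (2022), §7 (7.7) p. 36, tex L1935–L1944; §5 Lemma 5.3 p. 25; §7 (7.2).
  [cite: Zhang2022LandauSiegel, §7 (7.7) p.36 tex L1935–L1944]
-/

noncomputable section

open Complex Real Finset

namespace Literature.NumberTheory.LFunctions.Zhang2022.Section7Eq77

open Skeleton Section7bStatements

/-! ## Divisor-function helpers -/

/-- `τ_{j+1}(n) ≤ d(n)ʲ` for `n ≠ 0` (`τ_k` = the tree's `MeanSquareMajorant.tau k = ζᵏ`) — divisor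
bookkeeping behind "`(κ∗a₁)(m) = O(τ₅(m))`" (tex L1903). [cite: Zhang2022LandauSiegel, §7 p. 35, tex L1903] -/
theorem tau_succ_le_card_divisors_pow (j : ℕ) {n : ℕ} (hn : n ≠ 0) :
    MeanSquareMajorant.tau (j + 1) n ≤ (n.divisors.card : ℝ) ^ j := by
  induction j generalizing n with
  | zero => rw [MeanSquareMajorant.tau_one_apply hn, pow_zero]
  | succ j ih =>
    rw [MeanSquareMajorant.tau_succ_apply]
    calc ∑ d ∈ n.divisors, MeanSquareMajorant.tau (j + 1) d
        ≤ ∑ d ∈ n.divisors, (n.divisors.card : ℝ) ^ j := by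
          refine Finset.sum_le_sum fun d hd => ?_
          have hd0 : d ≠ 0 := (Nat.pos_of_mem_divisors hd).ne'
          refine (ih hd0).trans (pow_le_pow_left₀ (Nat.cast_nonneg _) ?_ j)
          exact_mod_cast Finset.card_le_card
            (Nat.divisors_subset_of_dvd hn (Nat.dvd_of_mem_divisors hd))
      _ = (n.divisors.card : ℝ) ^ (j + 1) := by
          rw [Finset.sum_const, nsmul_eq_mul, pow_succ']

/-- `τ₅(n) ≤ d(n)⁴` ("`(κ∗a₁)(m) = O(τ₅(m))`", tex L1903, in the `d(·)`-form of the §14 window lemma).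
[cite: Zhang2022LandauSiegel, §7 p. 35, tex L1903] -/
theorem tau_five_le (n : ℕ) : MeanSquareMajorant.tau 5 n ≤ (n.divisors.card : ℝ) ^ 4 := by
  rcases eq_or_ne n 0 with rfl | hn
  · simp
  · exact tau_succ_le_card_divisors_pow 4 hn

/-- **`|(κ∗a₁)(m)| ≤ B·d(m)⁴`** for `|a₁| ≤ B` ("Note that `(κ∗a₁)(m) = O(τ₅(m))`", tex L1903; the
tree's `Section7aStatements.norm_kconv_le_tau_five` and `τ₅ ≤ d⁴`).
[cite: Zhang2022LandauSiegel, §7 p. 35, tex L1903] -/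
theorem norm_kappaConv_le_card (c' : ℝ) {D : ℕ} {a₁ : ℕ → ℂ} {B : ℝ} (ha : ∀ n, ‖a₁ n‖ ≤ B)
    (m : ℕ) : ‖kappaConv c' D a₁ m‖ ≤ B * (m.divisors.card : ℝ) ^ 4 := by
  have hB : 0 ≤ B := (norm_nonneg _).trans (ha 0)
  have h := Section7aStatements.norm_kconv_le_tau_five c' (D := D) ha m
  rw [kappaConv_eq_conv]
  exact h.trans (mul_le_mul_of_nonneg_left (tau_five_le m) hB)

/-- `|e(lk̄/p)| = 1`, hence `|1 − e(lk̄/p)| ≤ 2`. [cite: Zhang2022LandauSiegel, §2 p. 3] -/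
theorem norm_one_sub_exp_twist_le (p l kb : ℕ) :
    ‖1 - Complex.exp (2 * π * I * ((l : ℂ) * (kb : ℂ) / (p : ℂ)))‖ ≤ 2 := by
  refine (norm_sub_le _ _).trans ?_
  rw [norm_one, norm_exp_twist]
  norm_num

/-! ## Bookkeeping of `N = ⌈PT⁻²⌉` -/

/-- `#{1 ≤ k < ⌈PT⁻²⌉} ≤ PT⁻²`. [cite: Zhang2022LandauSiegel, §7 (7.2)] -/
theorem card_Ico_Nsupp_le (D : ℕ) : ((Ico 1 (Nsupp D)).card : ℝ) ≤ bigP D / bigT D ^ 2 := by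
  rw [Nat.card_Ico]
  have h0 : 0 ≤ bigP D / bigT D ^ 2 :=
    div_nonneg (Real.exp_pos _).le (pow_nonneg (Real.exp_pos _).le 2)
  have h1 : (Nsupp D : ℝ) < bigP D / bigT D ^ 2 + 1 := Nat.ceil_lt_add_one h0
  rcases Nat.eq_zero_or_pos (Nsupp D) with h | h
  · rw [h]; simpa using h0
  · have : ((Nsupp D - 1 : ℕ) : ℝ) = (Nsupp D : ℝ) - 1 := by
      rw [Nat.cast_sub h, Nat.cast_one]
    rw [this]; linarith

/-- `1 + log #{1 ≤ k < ⌈PT⁻²⌉} ≤ 2𝓛⁹` (`PT⁻² ≤ P = e^{𝓛⁹}`, `𝓛 ≥ 1`).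
[cite: Zhang2022LandauSiegel, §7 (7.2)] -/
theorem one_add_log_card_le {D : ℕ} (hℓ1 : 1 ≤ ell D) :
    1 + Real.log ((Ico 1 (Nsupp D)).card : ℕ) ≤ 2 * ell D ^ 9 := by
  have h9 : (1 : ℝ) ≤ ell D ^ 9 := one_le_pow₀ hℓ1
  have hP0 : 0 < bigP D := Real.exp_pos _
  have hle : (((Ico 1 (Nsupp D)).card : ℕ) : ℝ) ≤ bigP D :=
    (card_Ico_Nsupp_le D).trans (div_le_self hP0.le (one_le_pow₀ (one_le_bigT D)))
  have hlog : Real.log (((Ico 1 (Nsupp D)).card : ℕ) : ℝ) ≤ ell D ^ 9 := by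
    rcases Nat.eq_zero_or_pos (Ico 1 (Nsupp D)).card with h0 | hpos
    · rw [h0, Nat.cast_zero, Real.log_zero]; positivity
    · rw [show ell D ^ 9 = Real.log (bigP D) by rw [bigP, Real.log_exp]]
      exact Real.log_le_log (by exact_mod_cast hpos) hle
  linarith

/-- `{1 ≤ d < ⌈PT⁻²⌉} = {1 ≤ d ≤ ⌈PT⁻²⌉ − 1}`. [cite: Zhang2022LandauSiegel, §7 (7.2)] -/
theorem Ico_Nsupp_eq_Icc (D : ℕ) : Ico 1 (Nsupp D) = Icc 1 (Nsupp D - 1) := by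
  ext m; simp only [Finset.mem_Ico, Finset.mem_Icc]; omega

/-- Members `k` of `{1 ≤ k < ⌈PT⁻²⌉}` satisfy `1 ≤ k < PT⁻² ≤ P`. [cite: Zhang2022LandauSiegel, §7 (7.2)] -/
theorem bounds_of_mem_Ico_Nsupp {D k : ℕ} (hk : k ∈ Ico 1 (Nsupp D)) :
    (1 : ℝ) ≤ k ∧ (k : ℝ) ≤ bigP D := by
  rw [Finset.mem_Ico] at hk
  refine ⟨by exact_mod_cast hk.1, ?_⟩
  have h1 : (k : ℝ) < bigP D / bigT D ^ 2 := Nat.lt_ceil.mp hk.2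
  exact (h1.trans_le (div_le_self (Real.exp_pos _).le (one_le_pow₀ (one_le_bigT D)))).le


/-! ## The window lemma at `X = qk` -/

/-- The window lemma of the §14 lane at `X = qk` with `1 ≤ q ≤ 2P`, `1 ≤ k ≤ P` (so `1 ≤ X`,
`log X ≤ 5𝓛⁹`): `Σ_l d(l)⁴|Δ(l/(qk))|` converges and is `≤ K_W·qk·𝓛⁶⁷⁴`.
[cite: Zhang2022LandauSiegel, §5 Lemma 5.3 p. 25] -/
theorem window_at {D : ℕ} {c C : ℝ} (hc : 0 ≤ c) (hC : 0 ≤ C) (hℓ3 : 3 ≤ ell D)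
    (h53 : ∀ x : ℝ, 0 < x →
      (x ≤ t0 D ^ (1.02 : ℝ) → ‖DeltaW D x - omegaW D (1 / 2 + 2 * π * x * I)‖ ≤
          C * alpha D * ‖omegaW D (1 / 2 + 2 * π * x * I)‖ + Real.exp (-c * ell D ^ 10)) ∧
      (t0 D ^ (1.02 : ℝ) < x → ‖DeltaW D x‖ ≤
        C * (Real.exp (-((1 : ℝ) / 100 * ell2 D * Real.log x) ^ 2) +
          Real.exp (-(x ^ (0.99 : ℝ)) / ell2 D))))
    {q k : ℝ} (hq1 : 1 ≤ q) (hq2 : q ≤ 2 * bigP D) (hk1 : 1 ≤ k)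
    (hkP : k ≤ bigP D) :
    Summable (fun l : ℕ => (l.divisors.card : ℝ) ^ 4 * ‖DeltaW D ((l : ℝ) / (q * k))‖) ∧
      ∑' l : ℕ, (l.divisors.card : ℝ) ^ 4 * ‖DeltaW D ((l : ℝ) / (q * k))‖ ≤
        ((2 * C + 3) * 7 ^ 16 + 4 * C) * (q * k) * ell D ^ 674 := by
  have hℓ1 : 1 ≤ ell D := by linarith
  have hP0 : 0 < bigP D := Real.exp_pos _
  have hlogP : Real.log (bigP D) = ell D ^ 9 := by rw [bigP, Real.log_exp]
  have hX1 : 1 ≤ q * k := by nlinarith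
  have hlogX : Real.log (q * k) ≤ 5 * ell D ^ 9 := by
    rw [Real.log_mul (by linarith) (by linarith)]
    have h2 : Real.log q ≤ Real.log 2 + ell D ^ 9 := by
      rw [← hlogP, ← Real.log_mul (by norm_num) hP0.ne']
      exact Real.log_le_log (by linarith) hq2
    have h3 : Real.log k ≤ ell D ^ 9 := by rw [← hlogP]; exact Real.log_le_log (by linarith) hkP
    have h4 : Real.log 2 ≤ 1 := by have := Real.log_two_lt_d9; linarith
    have h5 : (1 : ℝ) ≤ ell D ^ 9 := one_le_pow₀ hℓ1
    linarith
  exact Typed.Sec14.tsum_divisors_pow_mul_norm_DeltaW_le hc hC hℓ3 h53 hX1 hlogX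

/-! ## The `d`-sum and the absorption into `PT⁻¹` -/

/-- **The `d`-sum**: if `|S(d)| ≤ K·d(d)⁴·#{k < PT⁻²}` for `1 ≤ d < PT⁻²` (`K ≥ 0`), then
`|Σ_{d<PT⁻²} d⁻¹S(d)| ≤ K·2¹⁶𝓛¹⁴⁴·PT⁻²` (`Σ_{d≤Y} d(d)⁴/d ≤ (1 + log Y)¹⁶`, `1 + log PT⁻² ≤ 2𝓛⁹`).
[cite: Zhang2022LandauSiegel, §7 (7.7) p. 36] -/
theorem outer_sum_le {D : ℕ} (hℓ1 : 1 ≤ ell D) {K : ℝ} (hK : 0 ≤ K) (S : ℕ → ℂ)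
    (hS : ∀ d ∈ Finset.Ico 1 (Skeleton.Nsupp D),
      ‖S d‖ ≤ K * (d.divisors.card : ℝ) ^ 4 * ((Finset.Ico 1 (Skeleton.Nsupp D)).card : ℝ)) :
    ‖∑ d ∈ Finset.Ico 1 (Skeleton.Nsupp D), 1 / (d : ℂ) * S d‖ ≤
      K * (2 ^ 16 * ell D ^ 144) * (bigP D / bigT D ^ 2) := by
  set Ik := Finset.Ico 1 (Skeleton.Nsupp D) with hIk
  have hcard : (Ik.card : ℝ) ≤ bigP D / bigT D ^ 2 := card_Ico_Nsupp_le D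
  have hlog : 1 + Real.log (Ik.card : ℕ) ≤ 2 * ell D ^ 9 := one_add_log_card_le hℓ1
  have hlog0 : 0 ≤ 1 + Real.log (Ik.card : ℕ) := by
    have : 0 ≤ Real.log (Ik.card : ℕ) := Real.log_natCast_nonneg _; linarith
  -- the divisor moment over `Ik = Icc 1 (N − 1)`, `#Ik = N − 1`
  have hdiv : ∑ d ∈ Ik, (d.divisors.card : ℝ) ^ 4 / d ≤ 2 ^ 16 * ell D ^ 144 := by
    have hcardeq : Ik.card = Skeleton.Nsupp D - 1 := by rw [hIk, Nat.card_Ico]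
    rw [hIk, Ico_Nsupp_eq_Icc]
    refine (sum_card_divisors_pow_div_le_log_pow 4 (Skeleton.Nsupp D - 1)).trans ?_
    rw [← hcardeq]
    calc (1 + Real.log (Ik.card : ℕ)) ^ (2 ^ 4) = (1 + Real.log (Ik.card : ℕ)) ^ 16 := by norm_num
      _ ≤ (2 * ell D ^ 9) ^ 16 := pow_le_pow_left₀ hlog0 hlog 16
      _ = 2 ^ 16 * ell D ^ 144 := by ring
  have hdiv0 : 0 ≤ ∑ d ∈ Ik, (d.divisors.card : ℝ) ^ 4 / d :=
    Finset.sum_nonneg fun d _ => by positivity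
  calc ‖∑ d ∈ Ik, 1 / (d : ℂ) * S d‖ ≤ ∑ d ∈ Ik, ‖1 / (d : ℂ) * S d‖ := norm_sum_le _ _
    _ ≤ ∑ d ∈ Ik, 1 / (d : ℝ) * (K * (d.divisors.card : ℝ) ^ 4 * (Ik.card : ℝ)) := by
        refine Finset.sum_le_sum fun d hd => ?_
        rw [norm_mul, norm_div, norm_one, Complex.norm_natCast]
        exact mul_le_mul_of_nonneg_left (hS d hd) (by positivity)
    _ = K * (Ik.card : ℝ) * ∑ d ∈ Ik, (d.divisors.card : ℝ) ^ 4 / d := by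
        rw [Finset.mul_sum]
        refine Finset.sum_congr rfl fun d _ => ?_
        ring
    _ ≤ K * (bigP D / bigT D ^ 2) * (2 ^ 16 * ell D ^ 144) := by
        have h1 : K * (Ik.card : ℝ) ≤ K * (bigP D / bigT D ^ 2) := mul_le_mul_of_nonneg_left hcard hK
        have h2 : 0 ≤ K * (bigP D / bigT D ^ 2) := by
          have : 0 ≤ bigP D / bigT D ^ 2 :=
            div_nonneg (Real.exp_pos _).le (pow_nonneg (Real.exp_pos _).le 2)
          positivity
        calc K * (Ik.card : ℝ) * ∑ d ∈ Ik, (d.divisors.card : ℝ) ^ 4 / d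
            ≤ K * (bigP D / bigT D ^ 2) * ∑ d ∈ Ik, (d.divisors.card : ℝ) ^ 4 / d :=
              mul_le_mul_of_nonneg_right h1 hdiv0
          _ ≤ K * (bigP D / bigT D ^ 2) * (2 ^ 16 * ell D ^ 144) :=
              mul_le_mul_of_nonneg_left hdiv h2
    _ = K * (2 ^ 16 * ell D ^ 144) * (bigP D / bigT D ^ 2) := by ring

/-- **Absorption**: if `M·𝓛⁸¹⁸ ≤ T` then `M·𝓛⁸¹⁸·PT⁻² ≤ 1·P·T⁻¹`. [cite: Zhang2022LandauSiegel, §6 p. 30] -/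
theorem absorb_le {D : ℕ} {M : ℝ} (hM : M * ell D ^ 818 ≤ bigT D) :
    M * ell D ^ 818 * (bigP D / bigT D ^ 2) ≤ 1 * bigP D * bigT D ^ (-(1 : ℝ)) := by
  have hT0 : 0 < bigT D := Real.exp_pos _
  have hP0 : 0 ≤ bigP D := (Real.exp_pos _).le
  have hq0 : 0 ≤ bigP D / bigT D ^ 2 := div_nonneg hP0 (pow_nonneg hT0.le 2)
  calc M * ell D ^ 818 * (bigP D / bigT D ^ 2) ≤ bigT D * (bigP D / bigT D ^ 2) :=
        mul_le_mul_of_nonneg_right hM hq0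
    _ = 1 * bigP D * bigT D ^ (-(1 : ℝ)) := by
        rw [Real.rpow_neg_one]
        field_simp

/-! ## Lemma 5.3 with a nonnegative constant -/

/-- Lemma 5.3 at `D` with the nonnegative constant `max C 0` in place of `C`.
[cite: Zhang2022LandauSiegel, §5 Lemma 5.3 p. 25] -/
theorem l53_max {D : ℕ} {c C : ℝ}
    (h : ∀ x : ℝ, 0 < x →
      (x ≤ t0 D ^ (1.02 : ℝ) → ‖DeltaW D x - omegaW D (1 / 2 + 2 * π * x * I)‖ ≤
          C * alpha D * ‖omegaW D (1 / 2 + 2 * π * x * I)‖ + Real.exp (-c * ell D ^ 10)) ∧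
      (t0 D ^ (1.02 : ℝ) < x → ‖DeltaW D x‖ ≤
        C * (Real.exp (-((1 : ℝ) / 100 * ell2 D * Real.log x) ^ 2) +
          Real.exp (-(x ^ (0.99 : ℝ)) / ell2 D)))) :
    ∀ x : ℝ, 0 < x →
      (x ≤ t0 D ^ (1.02 : ℝ) → ‖DeltaW D x - omegaW D (1 / 2 + 2 * π * x * I)‖ ≤
          max C 0 * alpha D * ‖omegaW D (1 / 2 + 2 * π * x * I)‖ + Real.exp (-c * ell D ^ 10)) ∧
      (t0 D ^ (1.02 : ℝ) < x → ‖DeltaW D x‖ ≤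
        max C 0 * (Real.exp (-((1 : ℝ) / 100 * ell2 D * Real.log x) ^ 2) +
          Real.exp (-(x ^ (0.99 : ℝ)) / ell2 D))) := by
  intro x hx
  have hα0 : 0 ≤ alpha D := by
    rw [alpha, bigP, Real.log_exp]
    exact div_nonneg Real.pi_pos.le (pow_nonneg (Real.log_natCast_nonneg D) 9)
  have hω0 : 0 ≤ ‖omegaW D (1 / 2 + 2 * π * x * I)‖ := norm_nonneg _
  have he0 : 0 ≤ Real.exp (-((1 : ℝ) / 100 * ell2 D * Real.log x) ^ 2) +
      Real.exp (-(x ^ (0.99 : ℝ)) / ell2 D) := by positivity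
  refine ⟨fun hx1 => ((h x hx).1 hx1).trans ?_, fun hx2 => ((h x hx).2 hx2).trans ?_⟩
  · have : C * alpha D * ‖omegaW D (1 / 2 + 2 * π * x * I)‖ ≤
        max C 0 * alpha D * ‖omegaW D (1 / 2 + 2 * π * x * I)‖ :=
      mul_le_mul_of_nonneg_right (mul_le_mul_of_nonneg_right (le_max_left _ _) hα0) hω0
    linarith
  · exact mul_le_mul_of_nonneg_right (le_max_left _ _) he0

end Literature.NumberTheory.LFunctions.Zhang2022.Section7Eq77
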